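import Summits.CriticalPhenomena.PercolationContinuityZ3.Theorems.PercNearOneGluingNoHeavyLowerTailSahiGridPatternFrozenBlock

/-!
# `NoHeavyLowerTail` (crux stmt-CriticalPhenomena-4575), Sahi programme P1: **THE FROZEN CORNER OF A TWO-ARM INNER BLOCK** —
# every diagonal certificate of `V = ↑a ∪ ↑b` (disjoint supports) equals `λ_V` POINTWISE on the corner `↑(a ∨ b) = ↑a ∩ ↑b`

Support file (Sahi cell, seat `prim-sahi-p1`, generation 42; `--supports stmt-CriticalPhenomena-4575`).  Pure proofs, no definitions, no `sorry`, standard axioms.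
Vocabulary of `…SahiGridPattern{DiagCert,FrozenBlock,CoCountProductNCrossedAligned}`.

THE MATHEMATICS (seat memo FROM-prim-sahi-p1-gen42 §8 (F1)).  `V = ↑a ∪ ↑b ⊆ [3]^k` with `a` supported on a coordinate set `Sx` and `b` supported off `Sx`.
For `p ≥ a ∨ b` the principal up-set `↑p` is the intersection of the two INDEPENDENT up-sets `{q : q_i ≥ p_i (i ∈ Sx)} ⊆ ↑a ⊆ V` and
`{q : q_i ≥ p_i (i ∉ Sx)} ⊆ ↑b ⊆ V`, so the frozen-block lemma of generation 34 (`diagCert_frozen_of_indep_sub`) pins `d(↑p) = λ_V(↑p)` for every `d` with (T) and (N);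
a downward induction on `#↑p` then pins `d` POINTWISE: **`diagCert_eq_lamU_on_corner`**: `d p = λ_V p` for all `p ≥ a ∨ b`.  Consequently (`diagCert_sum_eq_on_corner`)
`Σ_F d = Σ_F λ_V` for every `F ⊆ ↑(a∨b)` — in particular for the footprint `A₀ ∩ B′` of EVERY crossed pair whose sections sit inside the two arms (`A₀ ⊆ ↑a`,
`B′ ⊆ ↑b`), the certificate mass is the Harris value `2^k#F + H_V(F)` exactly; this is the 'law `LB_g = −base`' observed in the seat's LPs (memo §2) and generation 34's
'`T` frozen at `5`' for `V = x ∨ y`.  Nothing here asserts Conjecture A or `PatternPos d` for `d ≥ 4`. [this work]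
-/

namespace Summit.CriticalPhenomena.PercolationContinuityZ3.Theorems.SahiGridPattern

open Finset SahiGrid3
open scoped BigOperators

variable {k : ℕ}

/-- **THE FROZEN CORNER (pointwise)**: for `V = ↑a ∪ ↑b` with `a` supported on `Sx` and `b` off `Sx`, every `d` with (T) and (N) for `V` has `d p = λ_V p`
for all `p ≥ a ∨ b`. [this work] -/
theorem diagCert_eq_lamU_on_corner {V : Finset (Pd k)} {a b : Pd k} {Sx : Finset (Fin k)}
    (hVm : ∀ q, q ∈ V ↔ (a ≤ q ∨ b ≤ q)) (haS : ∀ i, i ∉ Sx → a i = 0) (hbS : ∀ i, i ∈ Sx → b i = 0)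
    (dV : Pd k → ℤ)
    (hT : ∀ W : Finset (Pd k), IsUpperSet (W : Set (Pd k)) → (∑ q ∈ W, dV q) ≤ ∑ q ∈ W, lamU V q)
    (hN : ∀ X X' : Finset (Pd k), IsUpperSet (X : Set (Pd k)) → IsUpperSet (X' : Set (Pd k)) →
      (∑ q ∈ X, ∑ r ∈ X', thetaVal V q r) ≤ ∑ q ∈ X ∩ X', dV q) :
    ∀ p : Pd k, a ≤ p → b ≤ p → dV p = lamU V p := by
  classical
  -- frozen principal up-sets inside the corner
  have hfro : ∀ p : Pd k, a ≤ p → b ≤ p →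
      (∑ q ∈ univ.filter (fun q : Pd k => p ≤ q), dV q) = ∑ q ∈ univ.filter (fun q : Pd k => p ≤ q), lamU V q := by
    intro p hap hbp
    set P : Finset (Pd k) := univ.filter (fun q : Pd k => ∀ i, i ∈ Sx → p i ≤ q i) with hP
    set Q : Finset (Pd k) := univ.filter (fun q : Pd k => ∀ i, i ∉ Sx → p i ≤ q i) with hQ
    have hPQ : P ∩ Q = univ.filter (fun q : Pd k => p ≤ q) := by
      ext q
      simp only [hP, hQ, Finset.mem_inter, Finset.mem_filter, Finset.mem_univ, true_and]
      constructor
      · rintro ⟨h1, h2⟩ i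
        by_cases hi : i ∈ Sx
        · exact h1 i hi
        · exact h2 i hi
      · intro h; exact ⟨fun i _ => h i, fun i _ => h i⟩
    have hPm : ∀ x y : Pd k, (∀ i ∈ Sx, x i = y i) → (x ∈ P ↔ y ∈ P) := by
      intro x y hxy
      simp only [hP, Finset.mem_filter, Finset.mem_univ, true_and]
      constructor
      · intro h i hi; rw [← hxy i hi]; exact h i hi
      · intro h i hi; rw [hxy i hi]; exact h i hi
    have hQm : ∀ x y : Pd k, (∀ i ∈ Sxᶜ, x i = y i) → (x ∈ Q ↔ y ∈ Q) := by
      intro x y hxy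
      simp only [hQ, Finset.mem_filter, Finset.mem_univ, true_and]
      constructor
      · intro h i hi; rw [← hxy i (Finset.mem_compl.2 hi)]; exact h i hi
      · intro h i hi; rw [hxy i (Finset.mem_compl.2 hi)]; exact h i hi
    have hPV : P ⊆ V := by
      intro q hq
      simp only [hP, Finset.mem_filter, Finset.mem_univ, true_and] at hq
      rw [hVm]
      refine Or.inl fun i => ?_
      by_cases hi : i ∈ Sx
      · exact le_trans (hap i) (hq i hi)
      · rw [haS i hi]; exact Fin.zero_le _
    have hQV : Q ⊆ V := by
      intro q hq
      simp only [hQ, Finset.mem_filter, Finset.mem_univ, true_and] at hq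
      rw [hVm]
      refine Or.inr fun i => ?_
      by_cases hi : i ∈ Sx
      · rw [hbS i hi]; exact Fin.zero_le _
      · exact le_trans (hbp i) (hq i hi)
    have hPu : IsUpperSet (P : Set (Pd k)) := by
      intro q r hqr hq
      rw [Finset.mem_coe] at hq ⊢
      simp only [hP, Finset.mem_filter, Finset.mem_univ, true_and] at hq ⊢
      exact fun i hi => le_trans (hq i hi) (hqr i)
    have hQu : IsUpperSet (Q : Set (Pd k)) := by
      intro q r hqr hq
      rw [Finset.mem_coe] at hq ⊢
      simp only [hQ, Finset.mem_filter, Finset.mem_univ, true_and] at hq ⊢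
      exact fun i hi => le_trans (hq i hi) (hqr i)
    have h := diagCert_frozen_of_indep_sub Sx Sxᶜ disjoint_compl_right hPm hQm hPV hQV hPu hQu dV hT hN
    rw [hPQ] at h
    exact h
  -- downward induction on the number of points above p
  suffices hmain : ∀ n : ℕ, ∀ p : Pd k, (univ.filter (fun q : Pd k => p ≤ q)).card = n → a ≤ p → b ≤ p → dV p = lamU V p by
    intro p hap hbp; exact hmain _ p rfl hap hbp
  intro n
  induction n using Nat.strong_induction_on with
  | _ n ih =>
    intro p hcard hap hbp
    have hpmem : p ∈ univ.filter (fun q : Pd k => p ≤ q) := by simp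
    -- split the frozen sum over ↑p into the point p and the points strictly above it
    have hsplit := hfro p hap hbp
    rw [← Finset.add_sum_erase _ _ hpmem, ← Finset.add_sum_erase _ _ hpmem] at hsplit
    -- every q strictly above p is in the corner and has fewer points above it
    have hrest : (∑ q ∈ (univ.filter (fun q : Pd k => p ≤ q)).erase p, dV q) = ∑ q ∈ (univ.filter (fun q : Pd k => p ≤ q)).erase p, lamU V q := by
      refine Finset.sum_congr rfl fun q hq => ?_
      rw [Finset.mem_erase, Finset.mem_filter] at hq
      obtain ⟨hne, _, hpq⟩ := hq
      have hlt : (univ.filter (fun r : Pd k => q ≤ r)).card < n := by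
        rw [← hcard]
        apply Finset.card_lt_card
        rw [Finset.ssubset_iff_subset_ne]
        refine ⟨fun r hr => ?_, fun heq => hne ?_⟩
        · rw [Finset.mem_filter] at hr ⊢
          exact ⟨hr.1, le_trans hpq hr.2⟩
        · have hp' : p ∈ univ.filter (fun r : Pd k => q ≤ r) := by rw [heq]; exact hpmem
          rw [Finset.mem_filter] at hp'
          exact le_antisymm hp'.2 hpq
      exact ih _ hlt q rfl (le_trans hap hpq) (le_trans hbp hpq)
    rw [hrest] at hsplit
    linarith

/-- **COROLLARY (frozen sums on the corner)**: for every `F` whose points all lie above `a ∨ b`, `Σ_{q∈F} d(q) = Σ_{q∈F} λ_V(q)`. [this work] -/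
theorem diagCert_sum_eq_on_corner {V : Finset (Pd k)} {a b : Pd k} {Sx : Finset (Fin k)}
    (hVm : ∀ q, q ∈ V ↔ (a ≤ q ∨ b ≤ q)) (haS : ∀ i, i ∉ Sx → a i = 0) (hbS : ∀ i, i ∈ Sx → b i = 0)
    (dV : Pd k → ℤ)
    (hT : ∀ W : Finset (Pd k), IsUpperSet (W : Set (Pd k)) → (∑ q ∈ W, dV q) ≤ ∑ q ∈ W, lamU V q)
    (hN : ∀ X X' : Finset (Pd k), IsUpperSet (X : Set (Pd k)) → IsUpperSet (X' : Set (Pd k)) →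
      (∑ q ∈ X, ∑ r ∈ X', thetaVal V q r) ≤ ∑ q ∈ X ∩ X', dV q)
    {F : Finset (Pd k)} (hF : ∀ q ∈ F, a ≤ q ∧ b ≤ q) :
    (∑ q ∈ F, dV q) = ∑ q ∈ F, lamU V q :=
  Finset.sum_congr rfl fun q hq => diagCert_eq_lamU_on_corner hVm haS hbS dV hT hN q (hF q hq).1 (hF q hq).2

end Summit.CriticalPhenomena.PercolationContinuityZ3.Theorems.SahiGridPattern
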